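import Literature.Analysis.FluidPDE.NSBoundedMildOseenDuhamel
import Literature.Analysis.FunctionSpaces.TestPairingLimits
import HarnessLib

/-!
# The Oseen Duhamel term of bounded fields in `L³`: tested majorants and the `L³` estimate
# by duality

Analysis/FluidPDE support file (everything proved, no definitions) for the discharge of the
named fact `kato_local_bounded` (`KatoContinuation.lean`: local Kato solutions from bounded `L³`
data with `L^∞` lifespan — Lemarié-Rieusset 2016, §9.9 and proof of Thm. 9.12, Oseen's scheme
`w = e^{νtΔ}a - B(w, w)` in `L^∞_{t,x}`, with the `L³` norm of the solution carried along). The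
scheme runs on the tree's bounded-field Duhamel term
`B^ν_s(u,v)(t) = oseenDuhamel ν s u v t` (`NSBoundedMildOseen.lean`; for bounded measurable fields
its absolute convergence, `L^∞` bound, tested identities and weak divergence-freeness are proved
in `NSBoundedMildOseenDuhamel.lean`). What the Kato class needs in addition is control of the
solution in `C([0,T); L³)`; this file supplies the `L³` size of the Duhamel term:

* `lintegral_enorm_mul_le_eLpNorm_three_threeHalves`, `lintegral_enorm_mul_lintegral_kernel_le`
  — Hölder `(3, 3/2)` and **the tested majorant** `∫ |F| (k ⋆ |φ|) ≤ ‖F‖₃ ‖k‖₁ ‖φ‖_{3/2}` for an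
  even integrable kernel `k` (Young `L¹ × L^{3/2} → L^{3/2}`, the tree's
  `UnboundedOperators.eLpNorm_convolution_le_lintegral_enorm_mul`);
* `enorm_setIntegral_integral_inner_le_of_majorant` — **the tested estimate**: for any kernel
  `G τ z p q` with an even, integrable, jointly measurable majorant `κ τ z ‖p‖ ‖q‖` on `(s, t)`,
  fields `‖u‖ ≤ M_u`, `‖v(τ)‖_{L³} ≤ N`, and a continuous compactly supported `φ`,
  `‖∫_{(s,t)×E} ∫_x ⟪G τ (x-y) u(τ,y) v(τ,y), φ x⟫‖ ≤ M_u N (∫_{(s,t)} ‖κ τ‖₁) ‖φ‖_{3/2}`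
  (Tonelli in `(τ, y)`, the tested majorant slice by slice) — stated for a general kernel so that
  it also serves the kernel *increments* of the time-continuity estimate
  (`OseenBoundedFieldsContinuity.lean`);
* `lintegral_Ioo_lintegral_oseenMajorant` — the parabolic majorant `C(ν(t-τ) + ‖z‖²)^{-(d+1)/2}`
  of Koch–Tataru's kernel bound (14) integrates to `C M₀ ν^{-1/2} 2√(t-s)` over `(s, t) × E`;
* `exists_eLpNorm_oseenDuhamel_three_le` — **the `L³` estimate**
  `‖B^ν_s(u,v)(t)‖_{L³} ≤ C M N ν^{-1/2} √(t-s)` for bounded measurable `u`, `v` (`‖u‖, ‖v‖ ≤ M`)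
  with `‖v(τ)‖_{L³} ≤ N` — the `L³` instance of the persistence estimate of Lemarié-Rieusset 2016,
  (7.32)–(7.33) with one factor in `L^∞` — **by duality**: against a test field the Duhamel term is
  the space–time integral of the tested kernel (`integral_inner_oseenDuhamel_eq_setIntegral`), the
  tested estimate bounds it by `M N Λ ‖φ‖_{3/2}`, and a bounded measurable field with this property
  lies in `L³` with norm `≤ M N Λ` (`FunctionSpaces.memLp_three_of_forall_abs_integral_inner_le`,
  `TestPairingLimits.lean`). No Minkowski integral inequality is needed.

## References

* P. G. Lemarié-Rieusset, *The Navier–Stokes Problem in the 21st Century*, CRC Press 2016,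
  doi:10.1201/b19556: Prop. 7.3 and its proof, (7.32)–(7.34) (PDF pp. 153–154); §9.9 and the
  proof of Thm. 9.12 (PDF p. 260). [LemarieRieusset2016]
* H. Koch, D. Tataru, *Well-posedness for the Navier–Stokes equations*, Adv. Math. 157 (2001),
  §2 (8), §3 (11)–(14). [KochTataruAdvMath2001]
-/

noncomputable section

open MeasureTheory TopologicalSpace Set Function Filter Metric InnerProductSpace
open _root_.Topology
open scoped ENNReal NNReal RealInnerProductSpace Convolution

namespace Literature.Analysis.FluidPDE

variable {E : Type*} [NormedAddCommGroup E] [InnerProductSpace ℝ E] [FiniteDimensional ℝ E]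
  [MeasurableSpace E] [BorelSpace E]

/-! ### Hölder and Young for the tested majorant -/

section HolderYoung

/-- Hölder with exponents `(3, 3/2)` in `∫⁻` form: `∫ |f| |g| ≤ ‖f‖₃ ‖g‖_{3/2}`. [folklore] -/
theorem lintegral_enorm_mul_le_eLpNorm_three_threeHalves {α : Type*} [MeasurableSpace α]
    {μ : Measure α} {F₁ F₂ : Type*} [NormedAddCommGroup F₁] [NormedAddCommGroup F₂]
    {f : α → F₁} {g : α → F₂} (hf : AEStronglyMeasurable f μ) (hg : AEStronglyMeasurable g μ) :
    ∫⁻ x, ‖f x‖ₑ * ‖g x‖ₑ ∂μ ≤ eLpNorm f 3 μ * eLpNorm g (3 / 2) μ := by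
  have hpq : (3 : ℝ).HolderConjugate (3 / 2) := Real.holderConjugate_iff.2 ⟨by norm_num, by norm_num⟩
  have h := ENNReal.lintegral_mul_le_Lp_mul_Lq μ hpq hf.enorm hg.enorm
  have e1 : eLpNorm f 3 μ = (∫⁻ x, ‖f x‖ₑ ^ (3 : ℝ) ∂μ) ^ (1 / (3 : ℝ)) := by
    rw [eLpNorm_eq_lintegral_rpow_enorm_toReal (by norm_num) (by norm_num)]
    norm_num
  have e2 : eLpNorm g (3 / 2) μ = (∫⁻ x, ‖g x‖ₑ ^ (3 / 2 : ℝ) ∂μ) ^ (1 / (3 / 2 : ℝ)) := by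
    have h32 : (3 / 2 : ℝ≥0∞) ≠ 0 := (ENNReal.div_pos (by norm_num) (by norm_num)).ne'
    have h32' : (3 / 2 : ℝ≥0∞) ≠ ⊤ := ENNReal.div_ne_top (by norm_num) (by norm_num)
    rw [eLpNorm_eq_lintegral_rpow_enorm_toReal h32 h32', ENNReal.toReal_div]
    norm_num
  rw [e1, e2]
  simpa only [Pi.mul_apply] using h

/-- **The tested majorant**: for an integrable, even, nonnegative kernel `k`, a continuous
compactly supported `φ` and `F ∈ L³`,
`∫_y ‖F(y)‖ ∫_x k(x - y) ‖φ(x)‖ dx dy ≤ ‖F‖₃ ‖k‖₁ ‖φ‖_{3/2}` (the inner integral is the convolution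
`k ⋆ |φ|` by evenness; Hölder `(3, 3/2)` and Young `L¹ × L^{3/2} → L^{3/2}`). [folklore] -/
theorem lintegral_enorm_mul_lintegral_kernel_le {k : E → ℝ} (hk0 : ∀ z, 0 ≤ k z)
    (hki : Integrable k) (hks : ∀ z, k (-z) = k z) {F : E → E} (hF : AEStronglyMeasurable F volume)
    {φ : E → E} (hφ : Continuous φ) (hφc : HasCompactSupport φ) :
    ∫⁻ y, ‖F y‖ₑ * ∫⁻ x, ENNReal.ofReal (k (x - y)) * ‖φ x‖ₑ ≤
      eLpNorm F 3 volume * (∫⁻ z, ‖k z‖ₑ) * eLpNorm φ (3 / 2) volume := by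
  set g : E → ℝ := fun x => ‖φ x‖ with hg
  have hgc : Continuous g := hφ.norm
  have hgs : HasCompactSupport g := hφc.norm
  obtain ⟨Cφ, hCφ⟩ := hgc.bounded_above_of_compact_support hgs
  -- the inner integral is the convolution `k ⋆ g`
  have hint : ∀ y, Integrable (fun x => k (x - y) * g x) := by
    intro y
    have h1 : Integrable (fun x => k (x - y)) := hki.comp_sub_right y
    refine (h1.norm.mul_const Cφ).mono' (h1.aestronglyMeasurable.mul hgc.aestronglyMeasurable)
      (Eventually.of_forall fun x => ?_)
    rw [Real.norm_eq_abs, abs_mul, abs_of_nonneg (norm_nonneg (φ x) : 0 ≤ g x)]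
    gcongr
    · exact le_of_eq (Real.norm_eq_abs _).symm
    · exact (le_abs_self _).trans (by simpa [hg] using hCφ x)
  have hconv : ∀ y, (k ⋆[ContinuousLinearMap.lsmul ℝ ℝ, volume] g) y = ∫ x, k (x - y) * g x := by
    intro y
    rw [MeasureTheory.convolution_eq_swap]
    refine integral_congr_ae (Eventually.of_forall fun x => ?_)
    simp only [ContinuousLinearMap.lsmul_apply, smul_eq_mul]
    rw [← neg_sub, hks]
  have hinner : ∀ y, ∫⁻ x, ENNReal.ofReal (k (x - y)) * ‖φ x‖ₑ =
      ‖(k ⋆[ContinuousLinearMap.lsmul ℝ ℝ, volume] g) y‖ₑ := by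
    intro y
    have hnn : 0 ≤ ∫ x, k (x - y) * g x := integral_nonneg fun x => mul_nonneg (hk0 _) (norm_nonneg _)
    rw [hconv, Real.enorm_eq_ofReal hnn, ofReal_integral_eq_lintegral_ofReal (hint y)
      (Eventually.of_forall fun x => mul_nonneg (hk0 _) (norm_nonneg _))]
    refine lintegral_congr fun x => ?_
    rw [ENNReal.ofReal_mul (hk0 _), ← ofReal_norm]
  simp_rw [hinner]
  -- Hölder, then Young
  have hconv_m : AEStronglyMeasurable (k ⋆[ContinuousLinearMap.lsmul ℝ ℝ, volume] g) volume :=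
    (hki.aestronglyMeasurable.convolution_integrand (ContinuousLinearMap.lsmul ℝ ℝ)
      hgc.aestronglyMeasurable).integral_prod_right'
  have h32 : (1 : ℝ≥0∞) ≤ 3 / 2 := by
    rw [ENNReal.le_div_iff_mul_le (Or.inl two_ne_zero) (Or.inl ENNReal.ofNat_ne_top)]; norm_num
  calc ∫⁻ y, ‖F y‖ₑ * ‖(k ⋆[ContinuousLinearMap.lsmul ℝ ℝ, volume] g) y‖ₑ
      ≤ eLpNorm F 3 volume * eLpNorm (k ⋆[ContinuousLinearMap.lsmul ℝ ℝ, volume] g) (3 / 2) volume :=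
        lintegral_enorm_mul_le_eLpNorm_three_threeHalves hF hconv_m
    _ ≤ eLpNorm F 3 volume * ((∫⁻ z, ‖k z‖ₑ) * eLpNorm g (3 / 2) volume) := by
        gcongr
        exact UnboundedOperators.eLpNorm_convolution_le_lintegral_enorm_mul hki.aestronglyMeasurable
          hgc.aestronglyMeasurable h32
    _ = eLpNorm F 3 volume * (∫⁻ z, ‖k z‖ₑ) * eLpNorm φ (3 / 2) volume := by
        rw [hg, eLpNorm_norm, mul_assoc]

end HolderYoung

/-! ### The tested estimate for a kernel with an even integrable majorant -/

section Tested

/-- **The tested estimate.** Let `G τ z p q` be a kernel with an even nonnegative majorant,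
`‖G τ z p q‖ ≤ κ τ z ‖p‖ ‖q‖` for `τ ∈ (s, t)`, `κ τ ∈ L¹`, jointly measurable. For fields `u`
bounded by `M_u` and `v` with `‖v(τ)‖_{L³} ≤ N` on `(s, t)`, and a continuous compactly supported
`φ`,
`‖∫_{(s,t)×E} (∫_x ⟪G τ (x-y) (u(τ,y)) (v(τ,y)), φ(x)⟫ dx) d(τ,y)‖ ≤
  M_u N (∫_{(s,t)} ‖κ τ‖₁ dτ) ‖φ‖_{3/2}` (Tonelli, the tested majorant
`lintegral_enorm_mul_lintegral_kernel_le` slice by slice). [folklore] -/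
theorem enorm_setIntegral_integral_inner_le_of_majorant
    {G : ℝ → E → E → E → E} {κ : ℝ → E → ℝ} {s t : ℝ}
    (hκ0 : ∀ τ ∈ Ioo s t, ∀ z, 0 ≤ κ τ z) (hκi : ∀ τ ∈ Ioo s t, Integrable (κ τ))
    (hκs : ∀ τ ∈ Ioo s t, ∀ z, κ τ (-z) = κ τ z) (hκm : Measurable (uncurry κ))
    (hG : ∀ τ ∈ Ioo s t, ∀ z p q, ‖G τ z p q‖ ≤ κ τ z * ‖p‖ * ‖q‖)
    {u v : ℝ → E → E} {Mu N : ℝ} (hMu : 0 ≤ Mu)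
    (hbu : ∀ τ ∈ Ioo s t, ∀ y, ‖u τ y‖ ≤ Mu)
    (hvm : ∀ τ ∈ Ioo s t, AEStronglyMeasurable (v τ) volume)
    (hv3 : ∀ τ ∈ Ioo s t, eLpNorm (v τ) 3 volume ≤ ENNReal.ofReal N)
    {φ : E → E} (hφ : Continuous φ) (hφc : HasCompactSupport φ) :
    ‖∫ p in Ioo s t ×ˢ univ, (∫ x, ⟪G p.1 (x - p.2) (u p.1 p.2) (v p.1 p.2), φ x⟫)
        ∂(volume : Measure (ℝ × E))‖ₑ ≤
      ENNReal.ofReal (Mu * N) * (∫⁻ τ in Ioo s t, ∫⁻ z, ENNReal.ofReal (κ τ z)) *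
        eLpNorm φ (3 / 2) volume := by
  set Φ : ℝ → E → ℝ≥0∞ := fun τ y => ∫⁻ x, ENNReal.ofReal (κ τ (x - y)) * ‖φ x‖ₑ with hΦ
  set L : ℝ → ℝ≥0∞ := fun τ => ∫⁻ z, ENNReal.ofReal (κ τ z) with hL
  have hLm : Measurable L := (hκm.ennreal_ofReal).lintegral_prod_right'
  -- slice estimate
  have hslice : ∀ τ ∈ Ioo s t,
      ∫⁻ y, ‖∫ x, ⟪G τ (x - y) (u τ y) (v τ y), φ x⟫‖ₑ ≤
        ENNReal.ofReal (Mu * N) * L τ * eLpNorm φ (3 / 2) volume := by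
    intro τ hτ
    have hpt : ∀ y, ‖∫ x, ⟪G τ (x - y) (u τ y) (v τ y), φ x⟫‖ₑ ≤
        ENNReal.ofReal Mu * (‖v τ y‖ₑ * Φ τ y) := by
      intro y
      calc ‖∫ x, ⟪G τ (x - y) (u τ y) (v τ y), φ x⟫‖ₑ
          ≤ ∫⁻ x, ‖⟪G τ (x - y) (u τ y) (v τ y), φ x⟫‖ₑ := enorm_integral_le_lintegral_enorm _
        _ ≤ ∫⁻ x, ENNReal.ofReal Mu * ‖v τ y‖ₑ * (ENNReal.ofReal (κ τ (x - y)) * ‖φ x‖ₑ) := by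
            refine lintegral_mono fun x => ?_
            rw [← ofReal_norm, ← ofReal_norm, ← ofReal_norm, ← ENNReal.ofReal_mul hMu,
              ← ENNReal.ofReal_mul (hκ0 τ hτ _), ← ENNReal.ofReal_mul (by positivity)]
            refine ENNReal.ofReal_le_ofReal ?_
            rw [Real.norm_eq_abs]
            calc |⟪G τ (x - y) (u τ y) (v τ y), φ x⟫| ≤ ‖G τ (x - y) (u τ y) (v τ y)‖ * ‖φ x‖ :=
                  abs_real_inner_le_norm _ _
              _ ≤ (κ τ (x - y) * ‖u τ y‖ * ‖v τ y‖) * ‖φ x‖ := by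
                  gcongr; exact hG τ hτ _ _ _
              _ ≤ (κ τ (x - y) * Mu * ‖v τ y‖) * ‖φ x‖ := by
                  gcongr
                  · exact hκ0 τ hτ _
                  · exact hbu τ hτ y
              _ = Mu * ‖v τ y‖ * (κ τ (x - y) * ‖φ x‖) := by ring
        _ = ENNReal.ofReal Mu * (‖v τ y‖ₑ * Φ τ y) := by
            rw [lintegral_const_mul' (ENNReal.ofReal Mu * ‖v τ y‖ₑ) _
              (ENNReal.mul_ne_top ENNReal.ofReal_ne_top enorm_ne_top), mul_assoc]
    calc ∫⁻ y, ‖∫ x, ⟪G τ (x - y) (u τ y) (v τ y), φ x⟫‖ₑ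
        ≤ ∫⁻ y, ENNReal.ofReal Mu * (‖v τ y‖ₑ * Φ τ y) := lintegral_mono hpt
      _ = ENNReal.ofReal Mu * ∫⁻ y, ‖v τ y‖ₑ * Φ τ y :=
          lintegral_const_mul' _ _ ENNReal.ofReal_ne_top
      _ ≤ ENNReal.ofReal Mu * (eLpNorm (v τ) 3 volume * (∫⁻ z, ‖κ τ z‖ₑ) * eLpNorm φ (3 / 2) volume) := by
          gcongr
          exact lintegral_enorm_mul_lintegral_kernel_le (hκ0 τ hτ) (hκi τ hτ) (hκs τ hτ) (hvm τ hτ) hφ hφc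
      _ ≤ ENNReal.ofReal Mu * (ENNReal.ofReal N * L τ * eLpNorm φ (3 / 2) volume) := by
          gcongr
          · exact hv3 τ hτ
          · refine le_of_eq (lintegral_congr fun z => ?_)
            rw [Real.enorm_eq_ofReal (hκ0 τ hτ z)]
      _ = ENNReal.ofReal (Mu * N) * L τ * eLpNorm φ (3 / 2) volume := by
          rw [ENNReal.ofReal_mul hMu]; ring
  -- integrate in `τ`
  calc ‖∫ p in Ioo s t ×ˢ univ, (∫ x, ⟪G p.1 (x - p.2) (u p.1 p.2) (v p.1 p.2), φ x⟫)
        ∂(volume : Measure (ℝ × E))‖ₑ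
      ≤ ∫⁻ p in Ioo s t ×ˢ univ, ‖∫ x, ⟪G p.1 (x - p.2) (u p.1 p.2) (v p.1 p.2), φ x⟫‖ₑ
          ∂(volume : Measure (ℝ × E)) := enorm_integral_le_lintegral_enorm _
    _ ≤ ∫⁻ τ in Ioo s t, ∫⁻ y, ‖∫ x, ⟪G τ (x - y) (u τ y) (v τ y), φ x⟫‖ₑ := by
        rw [volume_restrict_prod_univ_eq_prod]
        exact lintegral_prod_le _
    _ ≤ ∫⁻ τ in Ioo s t, ENNReal.ofReal (Mu * N) * L τ * eLpNorm φ (3 / 2) volume :=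
        setLIntegral_mono' measurableSet_Ioo fun τ hτ => hslice τ hτ
    _ = ENNReal.ofReal (Mu * N) * (∫⁻ τ in Ioo s t, L τ) * eLpNorm φ (3 / 2) volume := by
        rw [lintegral_mul_const _ (hLm.const_mul _), lintegral_const_mul _ hLm]

end Tested

/-! ### The `L³` estimate of the Duhamel term of bounded fields -/

section L3

variable {ν s T M : ℝ} {u v : ℝ → E → E}

/-- **The parabolic majorant of the Oseen kernel integrates to `C M₀ ν^{-1/2} 2√(t-s)`** over
`(s, t) × E`: with `κ τ z = C (ν(t-τ) + ‖z‖²)^{-(d+1)/2}`,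
`∫_{(s,t)} ∫ κ τ z dz dτ = C M₀ ν^{-1/2} · 2√(t-s)`, `M₀ = ∫ (1 + ‖w‖²)^{-(d+1)/2} dw`. [folklore] -/
theorem lintegral_Ioo_lintegral_oseenMajorant {C : ℝ} (hC : 0 ≤ C) (hν : 0 < ν) {s t : ℝ}
    (hst : s < t) :
    ∫⁻ τ in Ioo s t, ∫⁻ z : E, ENNReal.ofReal
        (C * (ν * (t - τ) + ‖z‖ ^ 2) ^ (-(((Module.finrank ℝ E : ℝ) + 1) / 2))) =
      ENNReal.ofReal (C * (∫ w : E, (1 + ‖w‖ ^ 2) ^ (-(((Module.finrank ℝ E : ℝ) + 1) / 2))) *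
        ν ^ (-(1 / 2 : ℝ)) * (2 * Real.sqrt (t - s))) := by
  set d : ℝ := (Module.finrank ℝ E : ℝ) with hd
  set e : ℝ := (d + 1) / 2 with he
  set M₀ : ℝ := ∫ w : E, (1 + ‖w‖ ^ 2) ^ (-e) with hM₀
  have hde : d < 2 * e := by rw [he]; linarith
  have hM₀ : 0 < M₀ := integral_one_add_norm_sq_rpow_neg_pos hde
  have hscal : d / 2 - e = -(1 / 2 : ℝ) := by rw [he]; ring
  have hinner : ∀ τ ∈ Ioo s t, ∫⁻ z : E, ENNReal.ofReal (C * (ν * (t - τ) + ‖z‖ ^ 2) ^ (-e)) =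
      ENNReal.ofReal (C * M₀ * ν ^ (-(1 / 2 : ℝ))) * ENNReal.ofReal ((t - τ) ^ (-(1 / 2 : ℝ))) := by
    intro τ hτ
    have hσ : 0 < ν * (t - τ) := mul_pos hν (sub_pos.2 hτ.2)
    calc ∫⁻ z : E, ENNReal.ofReal (C * (ν * (t - τ) + ‖z‖ ^ 2) ^ (-e))
        = ∫⁻ z : E, ENNReal.ofReal C * ENNReal.ofReal ((ν * (t - τ) + ‖z‖ ^ 2) ^ (-e)) := by
          refine lintegral_congr fun z => ?_
          rw [ENNReal.ofReal_mul hC]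
      _ = ENNReal.ofReal C * ENNReal.ofReal ((ν * (t - τ)) ^ (d / 2 - e) * M₀) := by
          rw [lintegral_const_mul' _ _ ENNReal.ofReal_ne_top, lintegral_add_norm_sq_rpow_neg hde hσ]
      _ = ENNReal.ofReal (C * M₀ * ν ^ (-(1 / 2 : ℝ))) * ENNReal.ofReal ((t - τ) ^ (-(1 / 2 : ℝ))) := by
          rw [hscal, Real.mul_rpow hν.le (sub_pos.2 hτ.2).le, ← ENNReal.ofReal_mul hC,
            ← ENNReal.ofReal_mul (by positivity)]
          congr 1; ring
  calc ∫⁻ τ in Ioo s t, ∫⁻ z : E, ENNReal.ofReal (C * (ν * (t - τ) + ‖z‖ ^ 2) ^ (-e))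
      = ∫⁻ τ in Ioo s t, ENNReal.ofReal (C * M₀ * ν ^ (-(1 / 2 : ℝ))) *
          ENNReal.ofReal ((t - τ) ^ (-(1 / 2 : ℝ))) := setLIntegral_congr_fun measurableSet_Ioo hinner
    _ = ENNReal.ofReal (C * M₀ * ν ^ (-(1 / 2 : ℝ))) * ENNReal.ofReal (2 * Real.sqrt (t - s)) := by
        rw [lintegral_const_mul' _ _ ENNReal.ofReal_ne_top, setLIntegral_Ioo_sub_rpow_neg_half_of_lt hst]
    _ = ENNReal.ofReal (C * M₀ * ν ^ (-(1 / 2 : ℝ)) * (2 * Real.sqrt (t - s))) := by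
        rw [← ENNReal.ofReal_mul (by positivity)]

omit [InnerProductSpace ℝ E] [FiniteDimensional ℝ E] in
/-- Measurability of the parabolic majorant `(τ, z) ↦ C (ν(t-τ) + ‖z‖²)^{-e}` (a composition of
measurable maps). [folklore] -/
theorem measurable_oseenMajorant (C ν t e : ℝ) :
    Measurable (uncurry fun (τ : ℝ) (z : E) => C * (ν * (t - τ) + ‖z‖ ^ 2) ^ (-e)) := by
  have h1 : Measurable fun p : ℝ × E => ν * (t - p.1) + ‖p.2‖ ^ 2 :=
    ((measurable_const.sub measurable_fst).const_mul ν).add (measurable_snd.norm.pow_const 2)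
  exact (h1.pow_const (-e)).const_mul C

/-- **The `L³` estimate of the Duhamel term of bounded fields** (the `L³` instance of the
persistence estimate of Lemarié-Rieusset 2016, (7.32)–(7.33), PDF pp. 153–154, with one factor
in `L^∞`: `‖B(F,G)(t)‖₃ ≤ C ∫₀ᵗ (ν(t-s))^{-1/2} ‖F‖_∞ ‖G‖₃ ds`). There is `C = C(E)` such that for
`ν > 0`, fields `u`, `v` measurable on `(s, T) × E` and bounded by `M` there, with
`‖v(τ)‖_{L³} ≤ N` for `τ ∈ (s, t)`, `s < t ≤ T`: `B^ν_s(u,v)(t) ∈ L³` and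
`‖B^ν_s(u,v)(t)‖_{L³} ≤ C M N ν^{-1/2} √(t - s)`. Proof by duality
(`memLp_three_of_forall_abs_integral_inner_le`): against a test field the Duhamel term is the
space–time integral of the tested kernel (`integral_inner_oseenDuhamel_eq_setIntegral`), bounded by
the tested estimate with the parabolic majorant of the kernel bound (14). [cite: LemarieRieusset2016, Prop. 7.3 proof, (7.32)–(7.33) (PDF pp. 153–154)] -/
theorem exists_eLpNorm_oseenDuhamel_three_le :
    ∃ C : ℝ, 0 < C ∧ ∀ {ν : ℝ}, 0 < ν → ∀ {u v : ℝ → E → E} {s T M N : ℝ}, 0 ≤ M → 0 ≤ N →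
      AEStronglyMeasurable (uncurry u) ((volume : Measure (ℝ × E)).restrict (Ioo s T ×ˢ univ)) →
      AEStronglyMeasurable (uncurry v) ((volume : Measure (ℝ × E)).restrict (Ioo s T ×ˢ univ)) →
      (∀ τ ∈ Ioo s T, ∀ y, ‖u τ y‖ ≤ M) → (∀ τ ∈ Ioo s T, ∀ y, ‖v τ y‖ ≤ M) →
      (∀ τ ∈ Ioo s T, AEStronglyMeasurable (v τ) volume) →
      ∀ {t : ℝ}, s < t → t ≤ T → (∀ τ ∈ Ioo s t, eLpNorm (v τ) 3 volume ≤ ENNReal.ofReal N) →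
        MemLp (oseenDuhamel ν s u v t) 3 volume ∧
          eLpNorm (oseenDuhamel ν s u v t) 3 volume ≤
            ENNReal.ofReal (C * M * N * ν ^ (-(1 / 2 : ℝ)) * Real.sqrt (t - s)) := by
  set d : ℝ := (Module.finrank ℝ E : ℝ) with hd
  set e : ℝ := (d + 1) / 2 with he
  set M₀ : ℝ := ∫ w : E, (1 + ‖w‖ ^ 2) ^ (-e) with hM₀
  have hde : d < 2 * e := by rw [he]; linarith
  have hM₀ : 0 < M₀ := integral_one_add_norm_sq_rpow_neg_pos hde
  obtain ⟨C₀, hC₀, hK⟩ := exists_norm_oseenKernel_le (E := E)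
  obtain ⟨Cs, hCs, hsup⟩ := exists_norm_oseenDuhamel_bounded_le (E := E)
  refine ⟨2 * C₀ * M₀, by positivity, fun {ν} hν {u v s T M N} hM hN hu hv huM hvM hvm {t} hst htT hv3 => ?_⟩
  set B : E → E := oseenDuhamel ν s u v t with hB
  -- the tested bound
  set κ : ℝ → E → ℝ := fun τ z => C₀ * (ν * (t - τ) + ‖z‖ ^ 2) ^ (-e) with hκ
  have hκ0 : ∀ τ ∈ Ioo s t, ∀ z, 0 ≤ κ τ z := fun τ hτ z =>
    mul_nonneg hC₀.le (Real.rpow_nonneg (by nlinarith [mul_pos hν (sub_pos.2 hτ.2), sq_nonneg ‖z‖]) _)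
  have hκs : ∀ τ ∈ Ioo s t, ∀ z, κ τ (-z) = κ τ z := fun τ _ z => by simp [hκ, norm_neg]
  have hκi : ∀ τ ∈ Ioo s t, Integrable (κ τ) := fun τ hτ =>
    (integrable_add_norm_sq_rpow_neg hde (mul_pos hν (sub_pos.2 hτ.2))).const_mul C₀
  have hκm : Measurable (uncurry κ) := measurable_oseenMajorant C₀ ν t e
  have hG : ∀ τ ∈ Ioo s t, ∀ z p q, ‖oseenKernel (ν * (t - τ)) z p q‖ ≤ κ τ z * ‖p‖ * ‖q‖ :=
    fun τ hτ z p q => hK (mul_pos hν (sub_pos.2 hτ.2)) z p q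
  set Λ : ℝ := C₀ * M₀ * ν ^ (-(1 / 2 : ℝ)) * (2 * Real.sqrt (t - s)) with hΛ
  have hΛ0 : 0 ≤ Λ := by positivity
  have hLint : ∫⁻ τ in Ioo s t, ∫⁻ z, ENNReal.ofReal (κ τ z) = ENNReal.ofReal Λ :=
    lintegral_Ioo_lintegral_oseenMajorant hC₀.le hν hst
  have htest : ∀ φ : E → E, FunctionSpaces.IsTestFunctionOn (⊤ : Opens E) φ →
      |∫ x, ⟪B x, φ x⟫| ≤ M * N * Λ * (eLpNorm φ (3 / 2 : ℝ≥0∞) volume).toReal := by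
    intro φ hφ
    have hφc := hφ.contDiff.continuous
    have hφs := hφ.hasCompactSupport
    obtain ⟨-, heq⟩ := integral_inner_oseenDuhamel_eq_setIntegral hν hu hv hM huM hvM hst htT hφc hφs
    rw [hB, heq]
    have h := enorm_setIntegral_integral_inner_le_of_majorant (G := fun τ => oseenKernel (ν * (t - τ)))
      hκ0 hκi hκs hκm hG hM (fun τ hτ => huM τ ⟨hτ.1, hτ.2.trans_le htT⟩)
      (fun τ hτ => hvm τ ⟨hτ.1, hτ.2.trans_le htT⟩) hv3 hφc hφs
    rw [hLint] at h
    have hφ32 : eLpNorm φ (3 / 2) volume < ⊤ := (hφc.memLp_of_hasCompactSupport (p := 3 / 2) hφs).2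
    have hfin : ENNReal.ofReal (M * N) * ENNReal.ofReal Λ * eLpNorm φ (3 / 2) volume ≠ ⊤ :=
      ENNReal.mul_ne_top (ENNReal.mul_ne_top ENNReal.ofReal_ne_top ENNReal.ofReal_ne_top) hφ32.ne
    rw [← Real.norm_eq_abs]
    calc ‖∫ p in Ioo s t ×ˢ univ, (∫ x, ⟪oseenKernel (ν * (t - p.1)) (x - p.2) (u p.1 p.2) (v p.1 p.2), φ x⟫)
            ∂(volume : Measure (ℝ × E))‖
        = (‖∫ p in Ioo s t ×ˢ univ, (∫ x, ⟪oseenKernel (ν * (t - p.1)) (x - p.2) (u p.1 p.2) (v p.1 p.2), φ x⟫)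
            ∂(volume : Measure (ℝ × E))‖ₑ).toReal := by simp
      _ ≤ (ENNReal.ofReal (M * N) * ENNReal.ofReal Λ * eLpNorm φ (3 / 2) volume).toReal :=
          ENNReal.toReal_mono hfin h
      _ = M * N * Λ * (eLpNorm φ (3 / 2 : ℝ≥0∞) volume).toReal := by
          rw [ENNReal.toReal_mul, ENNReal.toReal_mul, ENNReal.toReal_ofReal (by positivity),
            ENNReal.toReal_ofReal hΛ0]
  -- measurability and local square integrability of the bounded slice
  have hBm : AEStronglyMeasurable B volume := aestronglyMeasurable_oseenDuhamel hν hu hv hM huM hvM hst htT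
  set Mb : ℝ := Cs * M ^ 2 * ν ^ (-(1 / 2 : ℝ)) * (2 * Real.sqrt (t - s)) with hMb
  have hBb : ∀ x, ‖B x‖ ≤ Mb := fun x => hsup hν hst hM (fun τ hτ => huM τ ⟨hτ.1, hτ.2.trans_le htT⟩)
    (fun τ hτ => hvM τ ⟨hτ.1, hτ.2.trans_le htT⟩) x
  have hB2 : LocallyIntegrable (fun x => ‖B x‖ ^ 2) volume := by
    have hmem : MemLp (fun x => ‖B x‖ ^ 2) ∞ volume :=
      memLp_top_of_bound (hBm.norm.pow 2) (Mb ^ 2) (Eventually.of_forall fun x => by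
        rw [Real.norm_eq_abs, abs_of_nonneg (by positivity)]
        exact pow_le_pow_left₀ (norm_nonneg _) (hBb x) 2)
    exact hmem.locallyIntegrable le_top
  have hmain := FunctionSpaces.memLp_three_of_forall_abs_integral_inner_le hBm hB2
    (by positivity : 0 ≤ M * N * Λ) htest
  refine ⟨hmain.1, hmain.2.trans (le_of_eq ?_)⟩
  congr 1
  rw [hΛ]; ring

end L3

end Literature.Analysis.FluidPDE

end
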